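import Literature.MathematicalPhysics.QuantumLattice.GrassmannKernels
import Literature.MathematicalPhysics.QuantumLattice.HubbardEffectiveAction
import Literature.MathematicalPhysics.QuantumLattice.PairCorrelations
import HarnessLib

/-!
# Certificate functionals of the symmetric (`h = 0`) regime of a Wilsonian effective action

Topic `Literature/MathematicalPhysics/QuantumLattice`; the model-independent CORE of the definition
request `defn-symmetricRegimeCertificate` (D1′b of route HubbardSuperconductivity/AposterioriCapRg,
rev 12; it types the cruxes `CapRgSymmetricCertificateCT` (producer, stmt-13959) and
`SeededBrokenRegimeBoseFermiCT` (consumer, stmt-13960)).  The request asks for ONE normalisation,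
fixed once, of the numbers a computer-assisted RG certificate reports about the effective action
`𝒢` of the `2D` Hubbard torus at an infrared scale `Λ` in the symmetric regime (no pair seed), and
for a predicate "`𝒢` is certified at accuracy `Θ` against physical data `π`" in the a-posteriori
format of Lanford / Koch–Wittwer / Figueras–Haro–Luque (finitely many inequalities on a computable
object).  This file fixes that normalisation for an ARBITRARY element `G : HubbardGrassmann L M`
(the effective action at finite torus side `L`, Matsubara count `2M`, inverse temperature `β`),
an arbitrary renormalised band `e : (ℤ/Lℤ)² → ℝ` on the lattice momenta (for the route:
`e_K = ε_L - μ - K`, the countertermed frame of the sibling request D1′a `hubbardEffectiveActionCT`)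
and its continuum version `eC : ℝ² → ℝ`; the thin model binding
`symmetricRegimeCertificate U μ π Θ K Λ L₀` over `hubbardEffectiveActionCT` is the sibling file
`SymmetricRegimeCertificate.lean`.

## The normalisation (Salmhofer 1998, §3.2 (3.12), §5.1, §5.3; BGM 2006 (2.2)–(2.6))

Momentum-space integration weight `ε = (βL²)⁻¹` (`∫dk = β⁻¹Σ_ω L⁻²Σ_k⃗`).  Writing
`G = Σ_m Σ_X F_m(X) ψ_{X₀}⋯ψ_{X_{m-1}}` with the plain antisymmetric kernels `F_m = kernel ℂ G m`
of `GrassmannKernels.lean`, the **`m`-point vertex function** is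

  `𝒱_m(X) = m! · ε^{1-m} · F_m(X)`                                    (`vertexFn`)

— `ε⁻¹` times Salmhofer's kernel `ε^{-m} F_m` w.r.t. `∫dX`, i.e. his momentum-space coefficient
function with the conservation `δ` (`= ε⁻¹𝟙`) removed (Salmhofer 1998, §5.1: `Ĝ = δ · I`), times
`m!` so that `𝒱_m(X)` IS the coefficient of the monomial `ψ_{X₀}⋯ψ_{X_{m-1}}` divided by `ε^{m-1}`.
In this normalisation the free action of BGM 2006 (2.2) has `𝒱₂(ψ̂⁺_{kσ}, ψ̂⁻_{kσ}) = -iω + e(k⃗)`,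
and the bare Hubbard interaction `hubbardInteraction L M β U` (BGM (2.6a)) has
`𝒱₄(ψ̂⁺_{k₁↑}, ψ̂⁻_{k₂↑}, ψ̂⁺_{k₃↓}, ψ̂⁻_{k₄↓}) = U` at conserving momenta: **the bare interaction
has norm `U`**, as requested.  Norms are SUP norms of vertex functions, `‖𝒱_m‖_∞ = max_X |𝒱_m(X)|`
(Salmhofer 1998, §5.3, `|F_m|₀`): the `L¹–L^∞` norm `kernelNorm` of `GrassmannKernels.lean`,
which is Salmhofer's POSITION-space norm (§4.1), grows in momentum space like `(M/β)^{m-2}` on a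
local vertex (free frequency sums) and is therefore not used raw here (the same observation as in
`HubbardScaleReport.lean`, "Design choices").

## Contents (namespace `Literature.MathematicalPhysics.QuantumLattice`)

Records (rational, with their sign constraints as proof fields, in the style of `HubbardScaleData`):
* `SymmetricRegimeData` `π` — frame regularity bound `κ_max` (for `Σ_n (1+|n|₁)^r |κ_n|`, decay
  exponent `r = symmetricFrameDecay = 6`), quartic bound `E₁ > 0`, Stoner margin `0 < σ < 1`,
  field-strength floor `0 < ζ ≤ 1`, velocity bounds `0 < v₁ ≤ v₂`, curvature bounds `0 < κ₁ ≤ κ₂`,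
  van Hove distance `d_vH > 0`, scale range `0 < Λ₁ ≤ Λ₂` (units `t = 1`).
* `SymmetricAccuracy` `Θ = (η₁, c₀, w)`, all `> 0`.
* fixed constants: Cooper margin `2` (`symmetricCooperMargin`), window `[1/8, 1/5]`
  (`symmetricWindowLower/Upper`), `r = 6`.

Functionals of `(L, M, β, e, Λ, G)`:
* `vertexFn`, `vertexSupNorm`; `selfEnergy` `Σ(K,σ) = 𝒱₂(ψ̂⁺_{Kσ}, ψ̂⁻_{Kσ})` (so the dressed inverse
  propagator is `-iω + e + Σ`); `omega0 M` (the index of `ω₀ = π/β`);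
* `momentumShell e Λ = S_Λ = {k⃗ : |e(k⃗)| ≤ Λ}`; `fermiMismatch` `m_Λ = max_{k⃗∈S_Λ,σ} |Re Σ((ω₀,k⃗),σ)|`;
* `fieldStrengthSpin` `z(k⃗,σ) = 1 - (Im Σ((ω₀,k⃗),σ) - Im Σ((-ω₀,k⃗),σ))/(2ω₀)` (the coefficient of
  `-iω` in the dressed inverse propagator, as a centred difference quotient over the two lowest
  frequencies) and its spin average `fieldStrength` `z(k⃗)`;
* `remainderWeightNorm` `ρ_Λ = Σ_{m ∉ {0,2,4}} Λ^{(m-4)/2} ‖𝒱_m‖_∞` — the exponents of Salmhofer 1998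
  Thm 1 (`‖G_m(t)‖ ≲ e^{t(m/2-2)}`, `ε_t = Λ`), charging every degree not pinned by the other clauses;
* Cooper channel: `cooperAmplitude` `𝒞(k⃗,k⃗') = 𝒱₄(ψ̂⁺_{(ω₀,k⃗')↑} ψ̂⁺_{(-ω₀,-k⃗')↓} ψ̂⁻_{(-ω₀,-k⃗)↓} ψ̂⁻_{(ω₀,k⃗)↑})`
  (pair `(k⃗↑,-k⃗↓) → (k⃗'↑,-k⃗'↓)` at the lowest frequencies; the configuration of
  `HubbardScaleReport.cooperVertex`; bare value `+U`), the BCS shell measure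
  `bcsMeasure` `ν_Λ(k⃗) = 1/(Λ L² (z(k⃗) + z(-k⃗)))` (so that `Σ_{k⃗∈S_Λ} ν g → ∮ g dℓ/((2π)² z |∇e|)`, the
  density of states per unit `e/z`: the one-loop flow of an eigenvalue `-λ` of the operator below is
  `dλ/d log(Λ/Λ') = λ²`, the BCS normalisation requested), the Cooper matrix
  `cooperMatrix` `A(k⃗,k⃗') = 𝟙_S(k⃗)𝟙_S(k⃗') √ν(k⃗) 𝒞(k⃗,k⃗') √ν(k⃗')` on `ℓ²((ℤ/Lℤ)²)`, the pairing strength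
  `pairingStrength` `λ_d = sup_{‖g‖=1} Re⟨g, -A g⟩ = -(lowest eigenvalue of the Hermitian part of A)`
  (`Matrix.supRayleigh` of `PairCorrelations.lean`), `IsB1g` (transformation under the tree's
  `d4Site` by `b1gChar`) and `CooperDominance A` — the bottom of `A` is attained on a `B₁g` unit
  vector `f` and every unit vector orthogonal to `f` has Rayleigh quotient `≥ bottom/2` (the lowest
  eigenvalue is simple, `d_{x²-y²}`, and every other eigenvalue is `≥ -λ_d/2`: Cooper margin `2`);
* particle–hole channel at transfer `q⃗`: `phVertex` `L_{σσ'}(k⃗,k⃗';q⃗) = 𝒱₄(ψ̂⁺_{k⃗+q⃗,σ} ψ̂⁻_{k⃗,σ} ψ̂⁺_{k⃗',σ'} ψ̂⁻_{k⃗'+q⃗,σ'})`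
  (all at `ω₀`), `chargeVertex` `Γ^c = -½ Σ_{σσ'} L_{σσ'}`, `spinVertex` `Γ^s = -½ Σ_{σσ'} (-1)^{σ+σ'} L_{σσ'}`
  (bare values `-U`, `+U`: instability-driving sign positive, RPA denominators `1 - Γχ`), the bubble
  `phBubble` `χ_Λ(k⃗;q⃗) = 𝔣_Λ(e/z (k⃗), e/z (k⃗+q⃗)) / (z(k⃗) z(k⃗+q⃗) L²)` with the Lindhard quotient
  `lindhardPair` `𝔣_Λ(a,a') = (f_Λ(a) - f_Λ(a'))/(a' - a)` (`= -f_Λ'(a)` at `a = a'`) of the Fermi function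
  `fermiFn` at temperature `Λ` — POSITIVE (`lindhardPair_pos`), the scale `Λ` itself being the
  infrared regulator of the below-scale modes (a frequency–momentum cutoff on `|iω - e|` suppresses the
  `q⃗ → 0` particle–hole bubble, Honerkamp–Salmhofer 2001, which is why the Pomeranchuk / ferromagnetic
  margins are taken in the temperature-like regularisation) — with legs on `S_Λ ∩ (S_Λ - q⃗)`
  (`transferShell`), the Stoner matrices `√χ Γ √χ` (`stonerMatrix`) and the Stoner products
  `stonerCharge/stonerSpin` `st^{c,s}(q⃗) = sup_{‖g‖=1} Re⟨g, √χ Γ^{c,s} √χ g⟩`;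
* continuum geometry of the renormalised Fermi curve (`partialD`, `gradSq`, `levelCurvature`,
  `vanHovePoints`, `ShellGeometry eC Λ v₁ v₂ κ₁ κ₂ d`): on `{p ∈ [-π,π]² : |eC p| ≤ Λ}`,
  `v₁² ≤ |∇eC|² ≤ v₂²`, `κ₁ ≤ |curvature of the level line| ≤ κ₂`, Euclidean distance to `(±π,0), (0,±π)`
  at least `d`.

Predicates:
* `SymmetricCertifiedAt π Θ Λ L M β e G Z` — clauses (0a) `Z ≠ 0`, (0b) `m_Λ ≤ c₀ Λ`, (0c)
  `z(k⃗,σ) ∈ [ζ, 1/ζ]` on `S_Λ`, (i′) `‖𝒱₄‖_∞ ≤ E₁ ∧ ρ_Λ ≤ η₁`, (ii′) `CooperDominance` and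
  `st^{c,s}(q⃗) ≤ 1 - σ` for every transfer `q⃗` (`q⃗ = 0` included), (iii′)
  `∃ a b : ℚ, 1/8 ≤ a ≤ b ≤ 1/5 ∧ b - a ≤ w ∧ λ_d ∈ [a, b]`;
* `SymmetricRegimeHolds π Θ frameNormVal eC Λ L₀ e G Z` — frame admissible (`frameNormVal ≤ κ_max`),
  `Λ ∈ [Λ₁, Λ₂]`, `ShellGeometry`, and `∀ L ≥ L₀, ∃ β₀, ∀ β ≥ β₀, ∃ M₀, ∀ M ≥ M₀, SymmetricCertifiedAt …`
  for families `e L`, `G L M β`, `Z L M β` (the model binding supplies them).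

## API (all proved)

`omega0` frequencies (`matsubaraFreq_omega0`, `matsubaraFreq_omega0_rev`); `vertexFn_zero`,
`vertexSupNorm_zero`, `vertexSupNorm_nonneg`, `norm_vertexFn_le_vertexSupNorm`; `fermiFn_mem_Ioo`,
`fermiFn_strictAnti`, **`lindhardPair_pos`**, `phBubble_nonneg`; `cooperMatrix_zero`,
`pairingStrength_zero` and **`not_symmetricCertifiedAt_zero`** (the requested junk test: the ZERO
effective action — the `U = 0` value of the Hubbard effective action — is never certified, because
`λ_d = 0 ∉ [1/8, 1/5]`); **`symmetricWindow_iff`** (clause (iii′) is equivalent to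
`λ_d ∈ [1/8, 1/5]`: the width `w` constrains the exhibited enclosure, not the truth value);
`not_shellGeometry_const` (non-vacuity of the speed floor).

## What is NOT claimed, and flags for the planner

* Nothing about any model: no instance of the predicates is asserted; `M → ∞`, `L → ∞` are
  quantifiers of `SymmetricRegimeHolds`, not limits taken here.
* `ρ_Λ` is an intrinsic functional of `G` (not an enclosure width), taken — as requested — with
  UNIT field radius: at tree level `‖𝒱_m‖_∞ ≈ ½ (2U)^{m/2-1} Λ^{-(m-4)/2}` (`m/2 - 2` integrated lines
  of size `≤ 2/Λ`), so `Λ^{(m-4)/2}‖𝒱_m‖_∞ ≈ ½(2U)^{m/2-1}` is `O(1)` in `Λ` but GEOMETRIC in `m`, and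
  already `ρ_Λ ≥ Λ‖𝒱₆‖_∞ ≈ 2U²`.  Consequences the planner should weigh before typing the cruxes:
  (a) at fixed `π` a producer quantifying over ALL `η₁ > 0` asks for `inf ρ_Λ = 0`; (b) at `U ∈ [2,3]`
  the tree-level terms grow with `m`, so the unit-radius sum over `m ≤ |Γ|` is not expected to be of
  order one, let alone small — the constructive form of such a hypothesis carries a field radius `h`
  (`Σ_m h^{m-4} Λ^{(m-4)/2} ‖𝒱_m‖_∞`) or growth constants (`Λ^{(m-4)/2}‖𝒱_m‖_∞ ≤ E₁ C₁^{m/2-1}`) among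
  the PHYSICAL data.
  The accuracy entries `c₀`, `w` do not have this feature.  A v2 under a new name can add the radius
  without touching the other clauses.
* Degree `2` is charged only through (0b)–(0c) (values at `±ω₀` on the shell), degree `4` through
  `‖𝒱₄‖_∞`, the Cooper and Stoner clauses; all other degrees through `ρ_Λ`.
* The Hermitian parts enter the spectral clauses through `Re⟨g, A g⟩`; no symmetry of `G`
  (spin rotation, parity, time reversal) is assumed by the definitions.

## Sources

M. Salmhofer, Commun. Math. Phys. 194 (1998) 249 (arXiv:cond-mat/9706188): §3.2 (3.12) (kernels
w.r.t. `∫dX = εΣ`), §4.1 (the `L¹–L^∞` norm), §4.2 Thm 1 (`‖G̃_{mr}(t)‖ ≤ γ_{mr} e^{t(m/2-2)}`, `m ≥ 6`),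
§5.1 (`Ĝ_{mr} = δ(p₁+…+p_m) I_{mr}`), §5.3 (`|F_m|₀ = sup |F_m|`), §6.2 and §7 p. 26 (the ladder
four-point function singles out the only singular contributions) [`Salmhofer1998`]; G. Benfatto, A. Giuliani, V. Mastropietro, Ann. Henri Poincaré 7 (2006) 809,
§2.1 (2.2)–(2.6) [`BenfattoGiulianiMastropietro2006`]; J. Feldman, H. Knörrer, E. Trubowitz, CMP 247
(2004) 1 (strictly convex, curved Fermi curves: the geometric hypotheses of (0d))
[`FeldmanKnorrerTrubowitz2004`]; C. Honerkamp, M. Salmhofer, Phys. Rev. B 64 (2001) 184516, §1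
("when the flow parameter is given by an infrared cutoff, the particle–hole excitations with small
total momentum are artificially suppressed above the scale set by the temperature")
[`HonerkampSalmhofer2001`];
D. J. Scalapino, Phys. Rep. 250 (1995) 329, §2 (`C₄ᵥ`, `B₁g`) [`Scalapino1995`]; format precedents
J.-Ll. Figueras, A. Haro, A. Luque, Found. Comput. Math. 17 (2017) 1123, Thm 2.5; O. E. Lanford,
Bull. AMS 6 (1982) 427; H. Koch, P. Wittwer, Math. Phys. Electron. J. 1 (1994).  The records and the
predicate themselves are posited by the route (planner evidence REPAIR_13882.md §2), like
`HubbardScaleData`.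
-/

noncomputable section

namespace Literature.MathematicalPhysics.QuantumLattice

open Literature.Probability.LatticeModels GrassmannAlgebra Finset Matrix

/-! ### §0 Fixed constants and the two rational records -/

/-- The decay exponent `r = 6` of the frame regularity norm `Σ_n (1 + |n|₁)^r |κ_n|` (fixed by the
request, "proposal 6"). [folklore] -/
def symmetricFrameDecay : ℕ := 6

/-- The Cooper dominance margin `2`: every Cooper eigenvalue other than the lowest is `≥ -λ_d/2`.
[folklore] -/
def symmetricCooperMargin : ℚ := 2

/-- The lower end `1/8` of the window for the `d`-wave pairing strength `λ_d(Λ)`. [folklore] -/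
def symmetricWindowLower : ℚ := 1 / 8

/-- The upper end `1/5` of the window for the `d`-wave pairing strength `λ_d(Λ)`. [folklore] -/
def symmetricWindowUpper : ℚ := 1 / 5

/-- **Physical data of the symmetric regime** (the record `π` of the request): rational bounds,
NOT small, against which a scale-`Λ` certificate is checked — the frame regularity bound `κ_max`
(on `Σ_n (1+|n|₁)^6 |κ_n|` for the counterterm `K = Σ_n κ_n cos(n·p)`; no degree bound), the quartic
bound `E₁ > 0`, the Stoner margin `0 < σ < 1`, the field-strength floor `0 < ζ ≤ 1`, velocity bounds
`0 < v₁ ≤ v₂` and curvature bounds `0 < κ₁ ≤ κ₂` of the renormalised Fermi curve, the van Hove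
distance `d_vH > 0` and the scale range `0 < Λ₁ ≤ Λ₂` (units: hopping `t = 1`).  A finite decidable
object; nothing about any model is asserted by inhabiting it (a-posteriori format, Figueras–Haro–Luque
2016 Thm 2.5; posited by route AposterioriCapRg, request D1′b). [folklore] -/
structure SymmetricRegimeData where
  /-- `κ_max`: bound on the frame regularity norm `Σ_n (1+|n|₁)^6 |κ_n|`. -/
  frameBound : ℚ
  /-- `E₁`: bound on the sup norm of the quartic vertex function. -/
  quarticBound : ℚ
  /-- `E₁ > 0`. -/
  quarticBound_pos : 0 < quarticBound
  /-- `σ`: the particle–hole (Stoner) margin. -/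
  stonerMargin : ℚ
  /-- `0 < σ`. -/
  stonerMargin_pos : 0 < stonerMargin
  /-- `σ < 1`. -/
  stonerMargin_lt_one : stonerMargin < 1
  /-- `ζ`: the field-strength floor, `z ∈ [ζ, 1/ζ]`. -/
  fieldFloor : ℚ
  /-- `0 < ζ`. -/
  fieldFloor_pos : 0 < fieldFloor
  /-- `ζ ≤ 1`. -/
  fieldFloor_le_one : fieldFloor ≤ 1
  /-- `v₁`: lower bound on `|∇e_K|` on the shell. -/
  velLower : ℚ
  /-- `v₂`: upper bound on `|∇e_K|` on the shell. -/
  velUpper : ℚ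
  /-- `0 < v₁`. -/
  velLower_pos : 0 < velLower
  /-- `v₁ ≤ v₂`. -/
  velLower_le : velLower ≤ velUpper
  /-- `κ₁`: lower bound on the curvature of the level lines of `e_K` on the shell. -/
  curvLower : ℚ
  /-- `κ₂`: upper bound on that curvature. -/
  curvUpper : ℚ
  /-- `0 < κ₁`. -/
  curvLower_pos : 0 < curvLower
  /-- `κ₁ ≤ κ₂`. -/
  curvLower_le : curvLower ≤ curvUpper
  /-- `d_vH`: distance of the shell from the van Hove points `(±π, 0), (0, ±π)`. -/
  vanHoveDist : ℚ
  /-- `0 < d_vH`. -/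
  vanHoveDist_pos : 0 < vanHoveDist
  /-- `Λ₁`: lower end of the admissible scale range. -/
  scaleLower : ℚ
  /-- `Λ₂`: upper end of the admissible scale range. -/
  scaleUpper : ℚ
  /-- `0 < Λ₁`. -/
  scaleLower_pos : 0 < scaleLower
  /-- `Λ₁ ≤ Λ₂`. -/
  scaleLower_le : scaleLower ≤ scaleUpper

/-- **Accuracy of a symmetric-regime certificate** (the record `Θ = (η₁, c₀, w)` of the request):
the remainder bound `η₁`, the Fermi-curve mismatch constant `c₀` (`m_Λ ≤ c₀ Λ`) and the width `w`
of the exhibited enclosure of `λ_d`; all positive. [folklore] -/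
structure SymmetricAccuracy where
  /-- `η₁`: bound on the weighted remainder norm `ρ_Λ`. -/
  remainder : ℚ
  /-- `0 < η₁`. -/
  remainder_pos : 0 < remainder
  /-- `c₀`: the Fermi-curve mismatch is at most `c₀ Λ`. -/
  mismatch : ℚ
  /-- `0 < c₀`. -/
  mismatch_pos : 0 < mismatch
  /-- `w`: width of the exhibited rational enclosure `[a, b] ∋ λ_d`. -/
  width : ℚ
  /-- `0 < w`. -/
  width_pos : 0 < width

namespace SymmetricRegimeData

variable (π : SymmetricRegimeData)

/-- `π.AdmitsFrameNorm n`: a frame whose regularity norm `Σ_n (1+|n|₁)^6 |κ_n|` is (at most) the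
real number `n` is admissible for `π`, i.e. `n ≤ κ_max`. [folklore] -/
def AdmitsFrameNorm (n : ℝ) : Prop := n ≤ π.frameBound

/-- `π.AdmitsScale Λ`: the real scale `Λ` lies in the admissible range `[Λ₁, Λ₂]`. [folklore] -/
def AdmitsScale (Λ : ℝ) : Prop := (π.scaleLower : ℝ) ≤ Λ ∧ Λ ≤ π.scaleUpper

/-- An admissible scale is positive. [folklore] -/
theorem AdmitsScale.pos {π : SymmetricRegimeData} {Λ : ℝ} (h : π.AdmitsScale Λ) : 0 < Λ :=
  lt_of_lt_of_le (by exact_mod_cast π.scaleLower_pos) h.1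

/-- The field-strength interval `[ζ, 1/ζ]` contains `1`. [folklore] -/
theorem fieldFloor_le_one_le_inv : (π.fieldFloor : ℝ) ≤ 1 ∧ (1 : ℝ) ≤ 1 / π.fieldFloor := by
  have h0 : (0 : ℝ) < π.fieldFloor := by exact_mod_cast π.fieldFloor_pos
  have h1 : (π.fieldFloor : ℝ) ≤ 1 := by exact_mod_cast π.fieldFloor_le_one
  exact ⟨h1, by rw [le_div_iff₀ h0]; linarith⟩

end SymmetricRegimeData

/-! ### §1 Vertex functions of a Grassmann polynomial and their sup norms -/

section Vertex

variable (L M : ℕ)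

/-- The **`m`-point vertex function** of `G` in the momentum-space normalisation with weight
`ε = (βL²)⁻¹`: `𝒱_m(X) = m! · ε^{1-m} · kernel G m X`, the coefficient of the monomial
`ψ_{X₀}⋯ψ_{X_{m-1}}` in `G` divided by `ε^{m-1}` — Salmhofer's kernel w.r.t. `∫dX = εΣ_X` with the
conservation `δ = ε⁻¹𝟙` removed (Salmhofer 1998 §5.1, `Ĝ = δ · I`); in it the free action has
`𝒱₂ = -iω + e` and the bare Hubbard interaction `𝒱₄ = U`.  (For `m = 0` this is the constant part.)
[cite: Salmhofer1998, §5.1] -/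
def vertexFn (β : ℝ) (G : HubbardGrassmann L M) (m : ℕ) (X : Fin m → HubbardFieldIdx L M) : ℂ :=
  (((m.factorial : ℝ) * (β * (L : ℝ) ^ 2) ^ (m - 1) : ℝ) : ℂ) * kernel ℂ G m X

/-- The **sup norm** `‖𝒱_m‖_∞ = max_X |𝒱_m(X)|` of the `m`-point vertex function (Salmhofer 1998,
§5.3, `|F_m|₀`; a finite maximum, `0` on an empty label set). [cite: Salmhofer1998, §5.3] -/
def vertexSupNorm (β : ℝ) (G : HubbardGrassmann L M) (m : ℕ) : ℝ :=
  ⨆ X : Fin m → HubbardFieldIdx L M, ‖vertexFn L M β G m X‖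

/-- Unfolding `vertexFn`. [folklore] -/
theorem vertexFn_def (β : ℝ) (G : HubbardGrassmann L M) (m : ℕ) (X : Fin m → HubbardFieldIdx L M) :
    vertexFn L M β G m X =
      (((m.factorial : ℝ) * (β * (L : ℝ) ^ 2) ^ (m - 1) : ℝ) : ℂ) * kernel ℂ G m X := rfl

/-- The zero polynomial has zero vertex functions. [folklore] -/
@[simp] theorem vertexFn_zero (β : ℝ) (m : ℕ) (X : Fin m → HubbardFieldIdx L M) :
    vertexFn L M β 0 m X = 0 := by
  simp [vertexFn]

/-- Vertex functions are additive in `G`. [folklore] -/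
theorem vertexFn_add (β : ℝ) (G G' : HubbardGrassmann L M) (m : ℕ) (X : Fin m → HubbardFieldIdx L M) :
    vertexFn L M β (G + G') m X = vertexFn L M β G m X + vertexFn L M β G' m X := by
  simp only [vertexFn, kernel_add, mul_add]

/-- Every value of the vertex function is bounded by the sup norm. [folklore] -/
theorem norm_vertexFn_le_vertexSupNorm [NeZero L] (β : ℝ) (G : HubbardGrassmann L M) (m : ℕ)
    (X : Fin m → HubbardFieldIdx L M) : ‖vertexFn L M β G m X‖ ≤ vertexSupNorm L M β G m :=
  le_ciSup (Finite.bddAbove_range fun X => ‖vertexFn L M β G m X‖) X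

/-- The sup norm is nonnegative. [folklore] -/
theorem vertexSupNorm_nonneg [NeZero L] (β : ℝ) (G : HubbardGrassmann L M) (m : ℕ) :
    0 ≤ vertexSupNorm L M β G m := by
  rcases isEmpty_or_nonempty (Fin m → HubbardFieldIdx L M) with h | h
  · haveI := h; simp [vertexSupNorm]
  · exact le_ciSup_of_le (Finite.bddAbove_range _) (Classical.arbitrary _) (norm_nonneg _)

/-- The zero polynomial has sup norms `0`. [folklore] -/
@[simp] theorem vertexSupNorm_zero (β : ℝ) (m : ℕ) : vertexSupNorm L M β (0 : HubbardGrassmann L M) m = 0 := by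
  simp [vertexSupNorm]

/-- The **weighted remainder norm** `ρ_Λ = Σ_{m ∉ {0,2,4}} Λ^{(m-4)/2} ‖𝒱_m‖_∞`: every degree not pinned
by the renormalisation conditions (degree `2`) or the quartic clauses (degree `4`), weighted by the
inverse of its size in the power counting of Salmhofer 1998 Thm 1 (`‖G_m(t)‖ ≤ γ e^{t(m/2-2)}` with
`ε_t = Λ`, i.e. `‖𝒱_m‖ ∼ Λ^{-(m-4)/2}`), so that irrelevant terms of natural size are `O(1)` and terms
larger than their scaling size are charged; degrees above `|Γ|` carry no monomials (the constant part,
degree `0`, is normalised away by `effAction`). [cite: Salmhofer1998, §4.2 Thm 1] -/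
def remainderWeightNorm [NeZero L] (β Λ : ℝ) (G : HubbardGrassmann L M) : ℝ :=
  ∑ m ∈ (Finset.range (Fintype.card (HubbardFieldIdx L M) + 1)).filter (fun m => m ≠ 0 ∧ m ≠ 2 ∧ m ≠ 4),
    Λ ^ (((m : ℝ) - 4) / 2) * vertexSupNorm L M β G m

/-- The weighted remainder norm is nonnegative (`Λ ≥ 0`). [folklore] -/
theorem remainderWeightNorm_nonneg [NeZero L] {Λ : ℝ} (hΛ : 0 ≤ Λ) (β : ℝ) (G : HubbardGrassmann L M) :
    0 ≤ remainderWeightNorm L M β Λ G :=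
  Finset.sum_nonneg fun m _ => mul_nonneg (Real.rpow_nonneg hΛ _) (vertexSupNorm_nonneg L M β G m)

/-- The zero polynomial has weighted remainder norm `0`. [folklore] -/
@[simp] theorem remainderWeightNorm_zero [NeZero L] (β Λ : ℝ) : remainderWeightNorm L M β Λ (0 : HubbardGrassmann L M) = 0 := by
  simp [remainderWeightNorm]

end Vertex

/-! ### §2 The lowest frequencies, the self-energy, the shell, mismatch and field strength -/

section SelfEnergy

variable (L M : ℕ)

/-- The index of the lowest positive Matsubara frequency `ω₀ = π/β` (integer label `n = 0`), for
`M ≥ 1`. [folklore] -/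
def omega0 [NeZero M] : MatsubaraIdx M := ⟨M, by have := NeZero.pos M; omega⟩

/-- `ω₀` has integer label `0`. [folklore] -/
@[simp] theorem matsubaraInt_omega0 [NeZero M] : matsubaraInt M (omega0 M) = 0 := by
  simp [matsubaraInt, omega0]

/-- `ω₀ = π/β`. [folklore] -/
theorem matsubaraFreq_omega0 [NeZero M] (β : ℝ) : matsubaraFreq β M (omega0 M) = Real.pi / β := by
  simp [matsubaraFreq]

/-- The reflected index is `-ω₀ = -π/β`. [folklore] -/
theorem matsubaraFreq_omega0_rev [NeZero M] (β : ℝ) : matsubaraFreq β M (omega0 M).rev = -(Real.pi / β) := by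
  rw [matsubaraFreq_rev, matsubaraFreq_omega0]

/-- The **normal self-energy** `Σ(K,σ) = 𝒱₂(ψ̂⁺_{Kσ}, ψ̂⁻_{Kσ})` of `G` at the frequency–momentum `K` and
spin `σ`: in the normalisation of BGM 2006 (2.2) the dressed inverse propagator of the fields below
scale is `-iω + e(k⃗) + Σ(K,σ)` (Salmhofer 1998 §2.5: `G₂` is the coefficient of the quadratic part of
the effective action). [cite: Salmhofer1998, §2.5] -/
def selfEnergy (β : ℝ) (G : HubbardGrassmann L M) (K : FreqMomentum L M) (σ : Fin 2) : ℂ :=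
  vertexFn L M β G 2 ![((K, σ), 0), ((K, σ), 1)]

/-- The zero polynomial has zero self-energy. [folklore] -/
@[simp] theorem selfEnergy_zero (β : ℝ) (K : FreqMomentum L M) (σ : Fin 2) :
    selfEnergy L M β 0 K σ = 0 := by
  simp [selfEnergy]

open Classical in
/-- The **momentum shell** `S_Λ = {k⃗ ∈ (ℤ/Lℤ)² : |e(k⃗)| ≤ Λ}` of half-width `Λ` around the
renormalised Fermi curve `{e = 0}`. [folklore] -/
def momentumShell [NeZero L] (e : TorusSite 2 L → ℝ) (Λ : ℝ) : Finset (TorusSite 2 L) :=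
  Finset.univ.filter fun k => |e k| ≤ Λ

variable {L} in
/-- Membership in the shell. [folklore] -/
@[simp] theorem mem_momentumShell [NeZero L] (e : TorusSite 2 L → ℝ) (Λ : ℝ) (k : TorusSite 2 L) :
    k ∈ momentumShell L e Λ ↔ |e k| ≤ Λ := by
  classical
  simp [momentumShell]

/-- The **Fermi-curve mismatch** `m_Λ = max_{k⃗ ∈ S_Λ, σ} |Re Σ((ω₀,k⃗),σ)|`: the static shift of the
dressed Fermi curve away from `{e = 0}` left on the shell (the renormalisation condition of the
countertermed frame is `m_Λ` small against `Λ`; Feldman–Salmhofer–Trubowitz: "keeping the Fermi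
surface fixed"); `0` on an empty shell. [folklore] -/
def fermiMismatch [NeZero L] [NeZero M] (β : ℝ) (e : TorusSite 2 L → ℝ) (Λ : ℝ) (G : HubbardGrassmann L M) : ℝ :=
  ⨆ kσ : {k // k ∈ momentumShell L e Λ} × Fin 2, |(selfEnergy L M β G (omega0 M, (kσ.1 : TorusSite 2 L)) kσ.2).re|

/-- The **field strength at spin `σ`**, `z(k⃗,σ) = 1 - (Im Σ((ω₀,k⃗),σ) - Im Σ((-ω₀,k⃗),σ)) / (2ω₀)`,
`ω₀ = π/β`: the coefficient of `-iω` in the dressed inverse propagator `-iω + e + Σ`, read off as the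
centred difference quotient of `Im Σ` over the two lowest frequencies `±ω₀` (so that at `±ω₀` exactly
`-iω + i Im Σ = -iω z` when `Im Σ` is odd in `ω`). [folklore] -/
def fieldStrengthSpin [NeZero M] (β : ℝ) (G : HubbardGrassmann L M) (k : TorusSite 2 L) (σ : Fin 2) : ℝ :=
  1 - ((selfEnergy L M β G (omega0 M, k) σ).im - (selfEnergy L M β G ((omega0 M).rev, k) σ).im) /
    (2 * (Real.pi / β))

/-- The **field strength** `z(k⃗) = ½(z(k⃗,↑) + z(k⃗,↓))` (spin average; the two agree for a
spin-symmetric `G`). [folklore] -/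
def fieldStrength [NeZero M] (β : ℝ) (G : HubbardGrassmann L M) (k : TorusSite 2 L) : ℝ :=
  (fieldStrengthSpin L M β G k 0 + fieldStrengthSpin L M β G k 1) / 2

/-- The zero polynomial has unit field strength at each spin. [folklore] -/
@[simp] theorem fieldStrengthSpin_zero [NeZero M] (β : ℝ) (k : TorusSite 2 L) (σ : Fin 2) :
    fieldStrengthSpin L M β (0 : HubbardGrassmann L M) k σ = 1 := by
  simp [fieldStrengthSpin]

/-- The zero polynomial has unit field strength. [folklore] -/
@[simp] theorem fieldStrength_zero [NeZero M] (β : ℝ) (k : TorusSite 2 L) :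
    fieldStrength L M β (0 : HubbardGrassmann L M) k = 1 := by
  norm_num [fieldStrength]

/-- The zero polynomial has zero Fermi-curve mismatch. [folklore] -/
@[simp] theorem fermiMismatch_zero [NeZero L] [NeZero M] (β : ℝ) (e : TorusSite 2 L → ℝ) (Λ : ℝ) :
    fermiMismatch L M β e Λ (0 : HubbardGrassmann L M) = 0 := by
  simp [fermiMismatch]

end SelfEnergy

/-! ### §3 The Cooper channel in BCS normalisation -/

section Cooper

variable (L M : ℕ)

/-- The **Cooper amplitude** `𝒞(k⃗,k⃗') = 𝒱₄(ψ̂⁺_{(ω₀,k⃗')↑}, ψ̂⁺_{(-ω₀,-k⃗')↓}, ψ̂⁻_{(-ω₀,-k⃗)↓}, ψ̂⁻_{(ω₀,k⃗)↑})`: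
the scattering of the pair `(k⃗↑, -k⃗↓)` at the lowest frequencies `(ω₀, -ω₀)` into `(k⃗'↑, -k⃗'↓)` — the
label configuration of `HubbardScaleReport.cooperVertex` (reduced BCS vertex; bare value `+U` for the
repulsive Hubbard interaction; Salmhofer 1998 p. 26: the particle–particle ladder with this kernel is
the singular flow, §6.2 and the Conclusion, p. 26 of the arXiv text). [cite: Salmhofer1998, §6.2 and §7 (p. 26)] -/
def cooperAmplitude [NeZero M] (β : ℝ) (G : HubbardGrassmann L M) (k k' : TorusSite 2 L) : ℂ :=
  vertexFn L M β G 4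
    ![(((omega0 M, k'), 0), 0), ((FreqMomentum.neg (omega0 M, k'), 1), 0),
      ((FreqMomentum.neg (omega0 M, k), 1), 1), (((omega0 M, k), 0), 1)]

/-- The **BCS shell measure** `ν_Λ(k⃗) = 1 / (Λ L² (z(k⃗) + z(-k⃗)))` on `S_Λ`: with it
`Σ_{k⃗ ∈ S_Λ} ν_Λ(k⃗) g(k⃗)` is a Riemann sum of `∮_{e=0} g dℓ / ((2π)² z |∇e|)`, the density of states per
unit quasiparticle energy `e/z`, so that the one-loop (ladder) flow of an eigenvalue `-λ` of the Cooper
operator below is `dλ / d log(Λ/Λ') = λ²` (the BCS normalisation of the request: `Λ_c = Λ e^{-1/λ_d}` is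
the one-loop pole). [folklore] -/
def bcsMeasure [NeZero M] (β Λ : ℝ) (G : HubbardGrassmann L M) (k : TorusSite 2 L) : ℝ :=
  1 / (Λ * (L : ℝ) ^ 2 * (fieldStrength L M β G k + fieldStrength L M β G (-k)))

/-- The **Cooper matrix** `A(k⃗,k⃗') = 𝟙_S(k⃗) 𝟙_S(k⃗') √ν(k⃗) 𝒞(k⃗,k⃗') √ν(k⃗')` on `ℓ²((ℤ/Lℤ)²)`: the Cooper
operator on `ℓ²(S_Λ, ν_Λ)` in the symmetric representation, extended by `0` off the shell (which adds
only zero eigenvalues). [folklore] -/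
def cooperMatrix [NeZero L] [NeZero M] (β : ℝ) (e : TorusSite 2 L → ℝ) (Λ : ℝ) (G : HubbardGrassmann L M) :
    Matrix (TorusSite 2 L) (TorusSite 2 L) ℂ :=
  Matrix.of fun k k' =>
    if k ∈ momentumShell L e Λ ∧ k' ∈ momentumShell L e Λ then
      ((Real.sqrt (bcsMeasure L M β Λ G k) : ℝ) : ℂ) * cooperAmplitude L M β G k k' *
        ((Real.sqrt (bcsMeasure L M β Λ G k') : ℝ) : ℂ)
    else 0

/-- The **`d`-wave pairing strength** `λ_d = sup_{‖g‖ = 1} Re⟨g, -A g⟩ = -(lowest eigenvalue of the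
Hermitian part of the Cooper matrix A)` (`Matrix.supRayleigh`; the instability-driving sign positive:
`λ_d > 0` iff some pair channel is attractive; `K = Λ/Λ_c = e^{1/λ_d}`). [folklore] -/
def pairingStrength [NeZero L] [NeZero M] (β : ℝ) (e : TorusSite 2 L → ℝ) (Λ : ℝ) (G : HubbardGrassmann L M) : ℝ :=
  (-cooperMatrix L M β e Λ G).supRayleigh

variable {L}

/-- `IsB1g f`: the function `f` on the torus momenta transforms in the representation `B₁g`
(`d_{x²-y²}`) of the point group `D₄ ≅ C₄ᵥ`: `f(γ k⃗) = χ_{B₁g}(γ) f(k⃗)` for the tree's action `d4Site`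
and character `b1gChar` (odd under the rotation by `π/2` and the diagonal reflections, even under
`k⃗ ↦ -k⃗`: a spin-singlet pair amplitude). [cite: Scalapino1995, §2] -/
def IsB1g (f : TorusSite 2 L → ℂ) : Prop :=
  ∀ (γ : DihedralGroup 4) (k : TorusSite 2 L), f (d4Site γ k) = b1gChar γ * f k

/-- The Rayleigh quotient `Re⟨g, A g⟩` of a complex matrix at the vector `g` (`= ⟨g, H g⟩` for the
Hermitian part `H` of `A`). [folklore] -/
def reRayleigh {n : Type*} [Fintype n] (A : Matrix n n ℂ) (g : n → ℂ) : ℝ :=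
  (star g ⬝ᵥ (A *ᵥ g)).re

/-- **Cooper dominance with margin `2`**: the bottom `inf_{‖g‖=1} Re⟨g, A g⟩ = -sup Re⟨g,-Ag⟩` of the
Cooper matrix is ATTAINED on a unit vector `f` of symmetry `B₁g`, and every unit vector orthogonal to
`f` has Rayleigh quotient at least half the bottom — for a negative bottom `-λ_d` this says: the lowest
eigenvalue is simple, its eigenvector is `d_{x²-y²}`, and every other eigenvalue (all symmetry sectors,
singlet and triplet, counted with multiplicity) is `≥ -λ_d/2` (Courant–Fischer). [folklore] -/
def CooperDominance [NeZero L] (A : Matrix (TorusSite 2 L) (TorusSite 2 L) ℂ) : Prop :=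
  ∃ f : TorusSite 2 L → ℂ, star f ⬝ᵥ f = 1 ∧ IsB1g f ∧ reRayleigh A f = -(-A).supRayleigh ∧
    ∀ g : TorusSite 2 L → ℂ, star g ⬝ᵥ g = 1 → star f ⬝ᵥ g = 0 →
      -(-A).supRayleigh / (symmetricCooperMargin : ℝ) ≤ reRayleigh A g

variable (L)

/-- The zero polynomial has zero Cooper amplitudes. [folklore] -/
@[simp] theorem cooperAmplitude_zero [NeZero M] (β : ℝ) (k k' : TorusSite 2 L) :
    cooperAmplitude L M β (0 : HubbardGrassmann L M) k k' = 0 := by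
  simp [cooperAmplitude]

/-- The zero polynomial has zero Cooper matrix. [folklore] -/
@[simp] theorem cooperMatrix_zero [NeZero L] [NeZero M] (β : ℝ) (e : TorusSite 2 L → ℝ) (Λ : ℝ) :
    cooperMatrix L M β e Λ (0 : HubbardGrassmann L M) = 0 := by
  ext k k'
  simp [cooperMatrix]

/-- The sup of the Rayleigh quotients of the zero matrix is `0` (nonempty index type). [folklore] -/
theorem supRayleigh_zero {n : Type*} [Fintype n] [Nonempty n] :
    (0 : Matrix n n ℂ).supRayleigh = 0 := by
  classical
  unfold Matrix.supRayleigh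
  haveI : Nonempty {v : n → ℂ // star v ⬝ᵥ v = 1} := by
    refine ⟨⟨Pi.single (Classical.arbitrary n) 1, ?_⟩⟩
    rw [dotProduct_single]
    simp
  simp

/-- **The zero polynomial has pairing strength `0`** (no attraction without interaction). [folklore] -/
@[simp] theorem pairingStrength_zero [NeZero L] [NeZero M] (β : ℝ) (e : TorusSite 2 L → ℝ) (Λ : ℝ) :
    pairingStrength L M β e Λ (0 : HubbardGrassmann L M) = 0 := by
  rw [pairingStrength, cooperMatrix_zero, neg_zero]
  exact supRayleigh_zero

end Cooper

/-! ### §4 The particle–hole channels: vertices, the scale-`Λ` bubble and the Stoner products -/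

section ParticleHole

variable (L M : ℕ)

/-- The **particle–hole vertex** at transfer `q⃗` and the lowest frequency,
`L_{σσ'}(k⃗,k⃗';q⃗) = 𝒱₄(ψ̂⁺_{(ω₀,k⃗+q⃗),σ}, ψ̂⁻_{(ω₀,k⃗),σ}, ψ̂⁺_{(ω₀,k⃗'),σ'}, ψ̂⁻_{(ω₀,k⃗'+q⃗),σ'})`: the coupling of
the bilinear `ψ̂⁺_{k⃗+q⃗,σ}ψ̂⁻_{k⃗,σ}` to its conjugate partner `ψ̂⁺_{k⃗',σ'}ψ̂⁻_{k⃗'+q⃗,σ'}` (bare values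
`L_{↑↓} = L_{↓↑} = U`, `L_{↑↑} = L_{↓↓} = 0`). [folklore] -/
def phVertex [NeZero M] (β : ℝ) (G : HubbardGrassmann L M) (q k k' : TorusSite 2 L) (σ σ' : Fin 2) : ℂ :=
  vertexFn L M β G 4
    ![(((omega0 M, k + q), σ), 0), (((omega0 M, k), σ), 1), (((omega0 M, k'), σ'), 0),
      (((omega0 M, k' + q), σ'), 1)]

/-- The **charge vertex** `Γ^c(k⃗,k⃗';q⃗) = -½ Σ_{σσ'} L_{σσ'}(k⃗,k⃗';q⃗)` (the density–density block, with
the instability-driving sign positive: bare value `-U`, RPA `χ_c = χ₀/(1 - Γ^c χ₀) = χ₀/(1 + Uχ₀)`).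
[folklore] -/
def chargeVertex [NeZero M] (β : ℝ) (G : HubbardGrassmann L M) (q k k' : TorusSite 2 L) : ℂ :=
  -(phVertex L M β G q k k' 0 0 + phVertex L M β G q k k' 0 1 + phVertex L M β G q k k' 1 0 +
      phVertex L M β G q k k' 1 1) / 2

/-- The **spin vertex** `Γ^s(k⃗,k⃗';q⃗) = -½ Σ_{σσ'} (-1)^{σ+σ'} L_{σσ'}(k⃗,k⃗';q⃗)` (the longitudinal spin
block, instability-driving sign positive: bare value `+U`, RPA `χ_s = χ₀/(1 - Γ^s χ₀) = χ₀/(1 - Uχ₀)`,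
the Stoner criterion). [folklore] -/
def spinVertex [NeZero M] (β : ℝ) (G : HubbardGrassmann L M) (q k k' : TorusSite 2 L) : ℂ :=
  -(phVertex L M β G q k k' 0 0 - phVertex L M β G q k k' 0 1 - phVertex L M β G q k k' 1 0 +
      phVertex L M β G q k k' 1 1) / 2

/-- The Fermi function `f_T(a) = 1/(e^{a/T} + 1)` at temperature `T`. [folklore] -/
def fermiFn (T a : ℝ) : ℝ := 1 / (Real.exp (a / T) + 1)

/-- The **Lindhard quotient** at temperature `T`: `𝔣_T(a,a') = (f_T(a) - f_T(a'))/(a' - a)` for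
`a ≠ a'` and its limit `-f_T'(a) = 1/(4T cosh²(a/2T))` at `a = a'` — the static particle–hole bubble
of two levels `a, a'` per unit volume. [folklore] -/
def lindhardPair (T a a' : ℝ) : ℝ :=
  if a = a' then 1 / (4 * T * Real.cosh (a / (2 * T)) ^ 2) else (fermiFn T a - fermiFn T a') / (a' - a)

/-- The **scale-`Λ` particle–hole bubble** resolved in the loop momentum,
`χ_Λ(k⃗;q⃗) = 𝔣_Λ(e(k⃗)/z(k⃗), e(k⃗+q⃗)/z(k⃗+q⃗)) / (z(k⃗) z(k⃗+q⃗) L²)`: the static bubble of the dressed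
propagators `z⁻¹/(-iω + e/z)` of the modes `k⃗, k⃗+q⃗` with the scale `Λ` as infrared regulator (Fermi
functions at temperature `Λ`; a frequency–momentum cutoff on `|iω - e|` would suppress the bubble at
`q⃗ → 0`, Honerkamp–Salmhofer 2001, whereas the Pomeranchuk / ferromagnetic margins are wanted);
nonnegative (`phBubble_nonneg`). [cite: HonerkampSalmhofer2001, §1 (arXiv pp. 3–4)] -/
def phBubble [NeZero M] (β : ℝ) (e : TorusSite 2 L → ℝ) (Λ : ℝ) (G : HubbardGrassmann L M)
    (q k : TorusSite 2 L) : ℝ :=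
  lindhardPair Λ (e k / fieldStrength L M β G k) (e (k + q) / fieldStrength L M β G (k + q)) /
    (fieldStrength L M β G k * fieldStrength L M β G (k + q) * (L : ℝ) ^ 2)

/-- The **transfer shell** `S_Λ ∩ (S_Λ - q⃗) = {k⃗ : k⃗ ∈ S_Λ ∧ k⃗ + q⃗ ∈ S_Λ}`: the loop momenta whose two
particle–hole legs both lie on the shell. [folklore] -/
def transferShell [NeZero L] (e : TorusSite 2 L → ℝ) (Λ : ℝ) (q : TorusSite 2 L) : Finset (TorusSite 2 L) :=
  (momentumShell L e Λ).filter fun k => k + q ∈ momentumShell L e Λ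

/-- The **Stoner matrix** `T(k⃗,k⃗') = 𝟙(k⃗) 𝟙(k⃗') √χ(k⃗) Γ(k⃗,k⃗') √χ(k⃗')` of a particle–hole vertex `Γ` and a
loop-resolved bubble `χ ≥ 0` with legs restricted to the finite set `S` (symmetric representation of
`Γ χ`; its top eigenvalue reaching `1` is the RPA / Stoner instability `1 - Γχ = 0`). [folklore] -/
def stonerMatrix (Γ : TorusSite 2 L → TorusSite 2 L → ℂ) (χ : TorusSite 2 L → ℝ) (S : Finset (TorusSite 2 L)) :
    Matrix (TorusSite 2 L) (TorusSite 2 L) ℂ :=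
  Matrix.of fun k k' =>
    if k ∈ S ∧ k' ∈ S then ((Real.sqrt (χ k) : ℝ) : ℂ) * Γ k k' * ((Real.sqrt (χ k') : ℝ) : ℂ) else 0

/-- The **charge Stoner product** `st^c(q⃗) = sup_{‖g‖=1} Re⟨g, √χ Γ^c √χ g⟩` at transfer `q⃗` (top
eigenvalue of the Hermitian part; legs on `S_Λ ∩ (S_Λ - q⃗)`; `0` when that set is empty). [folklore] -/
def stonerCharge [NeZero L] [NeZero M] (β : ℝ) (e : TorusSite 2 L → ℝ) (Λ : ℝ) (G : HubbardGrassmann L M)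
    (q : TorusSite 2 L) : ℝ :=
  (stonerMatrix L (chargeVertex L M β G q) (phBubble L M β e Λ G q) (transferShell L e Λ q)).supRayleigh

/-- The **spin Stoner product** `st^s(q⃗) = sup_{‖g‖=1} Re⟨g, √χ Γ^s √χ g⟩` at transfer `q⃗`. [folklore] -/
def stonerSpin [NeZero L] [NeZero M] (β : ℝ) (e : TorusSite 2 L → ℝ) (Λ : ℝ) (G : HubbardGrassmann L M)
    (q : TorusSite 2 L) : ℝ :=
  (stonerMatrix L (spinVertex L M β G q) (phBubble L M β e Λ G q) (transferShell L e Λ q)).supRayleigh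

variable {L M}

/-- The Fermi function takes values in `(0, 1)`. [folklore] -/
theorem fermiFn_mem_Ioo (T a : ℝ) : fermiFn T a ∈ Set.Ioo (0 : ℝ) 1 := by
  have h : 0 < Real.exp (a / T) + 1 := by positivity
  refine ⟨by unfold fermiFn; positivity, ?_⟩
  rw [fermiFn, div_lt_one h]
  linarith [Real.exp_pos (a / T)]

/-- At positive temperature the Fermi function is strictly decreasing. [folklore] -/
theorem fermiFn_strictAnti {T : ℝ} (hT : 0 < T) : StrictAnti (fermiFn T) := by
  intro a b hab
  simp only [fermiFn]
  have ha : 0 < Real.exp (a / T) + 1 := by positivity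
  have : Real.exp (a / T) < Real.exp (b / T) := Real.exp_lt_exp.2 (div_lt_div_of_pos_right hab hT)
  exact one_div_lt_one_div_of_lt ha (by linarith)

/-- **The Lindhard quotient is positive** at positive temperature (a decreasing Fermi function has
positive difference quotients `(f(a) - f(a'))/(a' - a)`, and `1/(4T cosh²) > 0`). [folklore] -/
theorem lindhardPair_pos {T : ℝ} (hT : 0 < T) (a a' : ℝ) : 0 < lindhardPair T a a' := by
  unfold lindhardPair
  split_ifs with h
  · have : 0 < Real.cosh (a / (2 * T)) := Real.cosh_pos _
    positivity
  · rcases lt_or_gt_of_ne h with hlt | hgt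
    · exact div_pos (sub_pos.2 (fermiFn_strictAnti hT hlt)) (sub_pos.2 hlt)
    · have h1 : fermiFn T a - fermiFn T a' < 0 := sub_neg.2 (fermiFn_strictAnti hT hgt)
      have h2 : a' - a < 0 := sub_neg.2 hgt
      exact div_pos_of_neg_of_neg h1 h2

/-- The Lindhard quotient is symmetric. [folklore] -/
theorem lindhardPair_comm (T a a' : ℝ) : lindhardPair T a a' = lindhardPair T a' a := by
  by_cases h : a = a'
  · subst h; rfl
  · rw [lindhardPair, lindhardPair, if_neg h, if_neg (Ne.symm h),
      div_eq_div_iff (sub_ne_zero.2 (Ne.symm h)) (sub_ne_zero.2 h)]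
    ring

/-- **The scale-`Λ` bubble is nonnegative wherever the field strengths are positive** (in particular
under clause (0c) of the certificate). [folklore] -/
theorem phBubble_nonneg [NeZero M] {β Λ : ℝ} (hΛ : 0 < Λ) {e : TorusSite 2 L → ℝ} {G : HubbardGrassmann L M}
    {q k : TorusSite 2 L} (hk : 0 < fieldStrength L M β G k) (hkq : 0 < fieldStrength L M β G (k + q)) :
    0 ≤ phBubble L M β e Λ G q k := by
  unfold phBubble
  exact div_nonneg (lindhardPair_pos hΛ _ _).le (by positivity)

end ParticleHole

/-! ### §5 Continuum geometry of the renormalised Fermi curve -/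

section Geometry

/-- The partial derivative `∂_i f(p)` of a function on `ℝ²` (Fréchet derivative applied to the
coordinate vector; `0` where `f` is not differentiable). [folklore] -/
def partialD (i : Fin 2) (f : (Fin 2 → ℝ) → ℝ) (p : Fin 2 → ℝ) : ℝ :=
  fderiv ℝ f p (Pi.single i 1)

/-- The squared length `|∇f(p)|² = (∂₀f)² + (∂₁f)²` of the gradient. [folklore] -/
def gradSq (f : (Fin 2 → ℝ) → ℝ) (p : Fin 2 → ℝ) : ℝ :=
  partialD 0 f p ^ 2 + partialD 1 f p ^ 2

/-- The **curvature of the level line** of `f` through `p`,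
`(∂₀₀f (∂₁f)² - 2 ∂₀₁f ∂₀f ∂₁f + ∂₁₁f (∂₀f)²) / |∇f|³` (signed so that the boundary of a convex
sublevel set has positive curvature; e.g. `1/|p|` for `f = |p|²`).  Only its absolute value enters the
certificate. [cite: FeldmanKnorrerTrubowitz2004, §1 (curvature hypothesis)] -/
def levelCurvature (f : (Fin 2 → ℝ) → ℝ) (p : Fin 2 → ℝ) : ℝ :=
  (partialD 0 (partialD 0 f) p * partialD 1 f p ^ 2 -
      2 * partialD 0 (partialD 1 f) p * partialD 0 f p * partialD 1 f p +
      partialD 1 (partialD 1 f) p * partialD 0 f p ^ 2) /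
    gradSq f p ^ ((3 : ℝ) / 2)

/-- The **van Hove points** `(±π, 0), (0, ±π)` of the square lattice (the saddle points of
`ε = -2(cos p₁ + cos p₂)`, where `∇ε = 0` on the half-filled Fermi curve), listed with their
representatives on the boundary of the square `[-π, π]²`. [folklore] -/
def vanHovePoints : List (Fin 2 → ℝ) :=
  [![Real.pi, 0], ![-Real.pi, 0], ![0, Real.pi], ![0, -Real.pi]]

/-- **`ShellGeometry eC Λ v₁ v₂ κ₁ κ₂ d`: the geometric bounds of the physical data on the continuum
shell** `{p ∈ [-π,π]² : |eC(p)| ≤ Λ}` of the renormalised band `eC` (a `2π`-periodic function, so the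
square suffices): the Fermi speed `|∇eC| ∈ [v₁, v₂]`, the curvature of the level lines in `[κ₁, κ₂]` in
absolute value (strictly convex, uniformly curved level curves: the hypotheses of Feldman–Knörrer–
Trubowitz 2004 on the Fermi curve), and Euclidean distance at least `d` from the van Hove points.
[cite: FeldmanKnorrerTrubowitz2004, §1] -/
def ShellGeometry (eC : (Fin 2 → ℝ) → ℝ) (Λ v₁ v₂ κ₁ κ₂ d : ℝ) : Prop :=
  ∀ p : Fin 2 → ℝ, (∀ i, |p i| ≤ Real.pi) → |eC p| ≤ Λ →
    (v₁ ^ 2 ≤ gradSq eC p ∧ gradSq eC p ≤ v₂ ^ 2) ∧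
    (κ₁ ≤ |levelCurvature eC p| ∧ |levelCurvature eC p| ≤ κ₂) ∧
    ∀ v ∈ vanHovePoints, d ^ 2 ≤ (p 0 - v 0) ^ 2 + (p 1 - v 1) ^ 2

/-- A constant band has no admissible shell geometry with a positive speed floor, as soon as its
shell is nonempty (non-vacuity of the velocity clause: `∇(const) = 0`). [folklore] -/
theorem not_shellGeometry_const {c Λ v₁ : ℝ} (hc : |c| ≤ Λ) (hv : 0 < v₁) (v₂ κ₁ κ₂ d : ℝ) :
    ¬ ShellGeometry (fun _ => c) Λ v₁ v₂ κ₁ κ₂ d := by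
  intro h
  have h0 := (h 0 (fun i => by simp [Real.pi_pos.le]) hc).1.1
  have : gradSq (fun _ : Fin 2 → ℝ => c) 0 = 0 := by simp [gradSq, partialD]
  rw [this] at h0
  linarith [pow_pos hv 2]

end Geometry

/-! ### §6 The certificate predicates -/

section Certificate

variable (π : SymmetricRegimeData) (Θ : SymmetricAccuracy)

/-- **`SymmetricCertifiedAt π Θ Λ L M β e G Z`: the effective action `G` (normaliser `Z`) at
`(L, M, β)` is certified at scale `Λ` against the physical data `π` to accuracy `Θ`, in the frame
with renormalised band `e`** — the conjunction of the request's clauses: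
(0a) `Z ≠ 0`; (0b) Fermi-curve mismatch `m_Λ ≤ c₀ Λ`; (0c) field strengths `z(k⃗,σ) ∈ [ζ, 1/ζ]` on the
shell; (i′) `‖𝒱₄‖_∞ ≤ E₁` and `ρ_Λ ≤ η₁`; (ii′) Cooper dominance with margin `2` of a `B₁g` bottom,
and the Stoner products `st^c(q⃗), st^s(q⃗) ≤ 1 - σ` at EVERY transfer `q⃗` (including `q⃗ = 0`:
Pomeranchuk / ferromagnetic margins); (iii′) an exhibited rational enclosure
`1/8 ≤ a ≤ λ_d ≤ b ≤ 1/5` of width `b - a ≤ w`.  (A-posteriori format: Figueras–Haro–Luque 2016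
Thm 2.5; posited by route AposterioriCapRg, request D1′b.) [folklore] -/
def SymmetricCertifiedAt (Λ : ℝ) (L M : ℕ) [NeZero L] [NeZero M] (β : ℝ) (e : TorusSite 2 L → ℝ)
    (G : HubbardGrassmann L M) (Z : ℂ) : Prop :=
  Z ≠ 0 ∧
  fermiMismatch L M β e Λ G ≤ Θ.mismatch * Λ ∧
  (∀ k ∈ momentumShell L e Λ, ∀ σ : Fin 2,
    (π.fieldFloor : ℝ) ≤ fieldStrengthSpin L M β G k σ ∧ fieldStrengthSpin L M β G k σ ≤ 1 / π.fieldFloor) ∧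
  (vertexSupNorm L M β G 4 ≤ π.quarticBound ∧ remainderWeightNorm L M β Λ G ≤ Θ.remainder) ∧
  (CooperDominance (cooperMatrix L M β e Λ G) ∧
    ∀ q : TorusSite 2 L, stonerCharge L M β e Λ G q ≤ 1 - π.stonerMargin ∧
      stonerSpin L M β e Λ G q ≤ 1 - π.stonerMargin) ∧
  ∃ a b : ℚ, symmetricWindowLower ≤ a ∧ a ≤ b ∧ b ≤ symmetricWindowUpper ∧ b - a ≤ Θ.width ∧
    (a : ℝ) ≤ pairingStrength L M β e Λ G ∧ pairingStrength L M β e Λ G ≤ b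

/-- **`SymmetricRegimeHolds π Θ n eC Λ L₀ e G Z`: the symmetric-regime certificate of a MODEL
FAMILY** — `e L` the renormalised band on the `L`-torus, `eC` its continuum version, `n` the frame
regularity norm, `G L M β` the effective action at scale `Λ` and `Z L M β` its normaliser: the frame
is admissible for `π` (`n ≤ κ_max`), `Λ ∈ [Λ₁, Λ₂]`, the continuum shell `{|eC| ≤ Λ}` obeys the
geometric bounds of `π` (clause (0d)), and for every `L ≥ L₀` there is `β₀` such that for every
`β ≥ β₀` there is `M₀` such that for every `M ≥ M₀` the effective action is certified
(`SymmetricCertifiedAt`).  The model binding `symmetricRegimeCertificate U μ π Θ K Λ L₀` of the sibling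
file instantiates the family with `hubbardEffectiveActionCT … U μ 0 K Λ`. [folklore] -/
def SymmetricRegimeHolds (frameNormVal : ℝ) (eC : (Fin 2 → ℝ) → ℝ) (Λ : ℝ) (L₀ : ℕ)
    (e : ∀ (L : ℕ) [NeZero L], TorusSite 2 L → ℝ) (G : ∀ (L M : ℕ) [NeZero L], ℝ → HubbardGrassmann L M)
    (Z : ∀ (L M : ℕ) [NeZero L], ℝ → ℂ) : Prop :=
  π.AdmitsFrameNorm frameNormVal ∧ π.AdmitsScale Λ ∧
  ShellGeometry eC Λ π.velLower π.velUpper π.curvLower π.curvUpper π.vanHoveDist ∧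
  ∀ L : ℕ, L₀ ≤ L → ∀ [NeZero L], ∃ β₀ : ℝ, ∀ β : ℝ, β₀ ≤ β → ∃ M₀ : ℕ, ∀ M : ℕ, M₀ ≤ M → ∀ [NeZero M],
    SymmetricCertifiedAt π Θ Λ L M β (e L) (G L M β) (Z L M β)

variable {π Θ}

/-- **The window clause is equivalent to `λ_d ∈ [1/8, 1/5]`**: an enclosure of any prescribed positive
width exists around every real number of the window (density of `ℚ`), so the width `w` constrains the
exhibited enclosure, not the truth value of the clause. [folklore] -/
theorem symmetricWindow_iff {w : ℚ} (hw : 0 < w) (x : ℝ) :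
    (∃ a b : ℚ, symmetricWindowLower ≤ a ∧ a ≤ b ∧ b ≤ symmetricWindowUpper ∧ b - a ≤ w ∧
        (a : ℝ) ≤ x ∧ x ≤ b) ↔
      x ∈ Set.Icc ((symmetricWindowLower : ℚ) : ℝ) ((symmetricWindowUpper : ℚ) : ℝ) := by
  constructor
  · rintro ⟨a, b, ha, -, hb, -, hax, hxb⟩
    exact ⟨(Rat.cast_le.2 ha).trans hax, hxb.trans (Rat.cast_le.2 hb)⟩
  · rintro ⟨hlo, hhi⟩
    have hw' : (0 : ℝ) < w := by exact_mod_cast hw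
    obtain ⟨a', ha'1, ha'2⟩ := exists_rat_btwn (show x - w / 2 < x by linarith)
    obtain ⟨b', hb'1, hb'2⟩ := exists_rat_btwn (show x < x + w / 2 by linarith)
    refine ⟨max a' symmetricWindowLower, min b' symmetricWindowUpper, le_max_right _ _, ?_,
      min_le_right _ _, ?_, ?_, ?_⟩
    · have h1 : ((max a' symmetricWindowLower : ℚ) : ℝ) ≤ x := by
        push_cast; exact max_le ha'2.le hlo
      have h2 : x ≤ ((min b' symmetricWindowUpper : ℚ) : ℝ) := by
        push_cast; exact le_min hb'1.le hhi
      exact_mod_cast h1.trans h2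
    · have : ((min b' symmetricWindowUpper : ℚ) : ℝ) - ((max a' symmetricWindowLower : ℚ) : ℝ) ≤ (w : ℝ) := by
        push_cast
        linarith [min_le_left (b' : ℝ) ((symmetricWindowUpper : ℚ) : ℝ),
          le_max_left (a' : ℝ) ((symmetricWindowLower : ℚ) : ℝ)]
      exact_mod_cast this
    · push_cast; exact max_le ha'2.le hlo
    · push_cast; exact le_min hb'1.le hhi

/-- **Junk test: the zero effective action is never certified** (whatever the data, accuracy, band,
scale and normaliser): its pairing strength is `λ_d = 0 ∉ [1/8, 1/5]`.  The effective action of the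
Hubbard torus at `U = 0` is `0` (`effAction C 0 = 0`), so the certificate is FALSE at `U = 0`, as the
request demands. [folklore] -/
theorem not_symmetricCertifiedAt_zero (Λ : ℝ) (L M : ℕ) [NeZero L] [NeZero M] (β : ℝ)
    (e : TorusSite 2 L → ℝ) (Z : ℂ) : ¬ SymmetricCertifiedAt π Θ Λ L M β e (0 : HubbardGrassmann L M) Z := by
  rintro ⟨-, -, -, -, -, a, b, ha, -, -, -, hax, -⟩
  rw [pairingStrength_zero] at hax
  have : (0 : ℚ) < a := lt_of_lt_of_le (by norm_num [symmetricWindowLower]) ha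
  have : (0 : ℝ) < a := by exact_mod_cast this
  linarith

/-- A model family whose effective action vanishes identically is never in the symmetric regime
(from `L₀` on, for any `L₀`). [folklore] -/
theorem not_symmetricRegimeHolds_zero (n : ℝ) (eC : (Fin 2 → ℝ) → ℝ) (Λ : ℝ) (L₀ : ℕ)
    (e : ∀ (L : ℕ) [NeZero L], TorusSite 2 L → ℝ) (Z : ∀ (L M : ℕ) [NeZero L], ℝ → ℂ) :
    ¬ SymmetricRegimeHolds π Θ n eC Λ L₀ e (fun L M _ _ => (0 : HubbardGrassmann L M)) Z := by
  rintro ⟨-, -, -, h⟩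
  haveI : NeZero (L₀ + 1) := ⟨Nat.succ_ne_zero _⟩
  obtain ⟨β₀, hβ₀⟩ := h (L₀ + 1) (Nat.le_succ _)
  obtain ⟨M₀, hM₀⟩ := hβ₀ β₀ le_rfl
  haveI : NeZero (M₀ + 1) := ⟨Nat.succ_ne_zero _⟩
  exact not_symmetricCertifiedAt_zero Λ (L₀ + 1) (M₀ + 1) β₀ (e (L₀ + 1)) (Z (L₀ + 1) (M₀ + 1) β₀)
    (hM₀ (M₀ + 1) (Nat.le_succ _))

/-- Under the certificate the scale-`Λ` bubble is nonnegative on the transfer shell (clause (0c) makes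
the field strengths at least `ζ > 0` on the shell). [folklore] -/
theorem SymmetricCertifiedAt.phBubble_nonneg {Λ : ℝ} {L M : ℕ} [NeZero L] [NeZero M] {β : ℝ}
    {e : TorusSite 2 L → ℝ} {G : HubbardGrassmann L M} {Z : ℂ} (hΛ : 0 < Λ)
    (h : SymmetricCertifiedAt π Θ Λ L M β e G Z) {q k : TorusSite 2 L} (hk : k ∈ transferShell L e Λ q) :
    0 ≤ phBubble L M β e Λ G q k := by
  obtain ⟨-, -, hz, -⟩ := h
  rw [transferShell, Finset.mem_filter] at hk
  have hζ : (0 : ℝ) < π.fieldFloor := by exact_mod_cast π.fieldFloor_pos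
  have hpos : ∀ k' ∈ momentumShell L e Λ, 0 < fieldStrength L M β G k' := fun k' hk' => by
    have h0 := (hz k' hk' 0).1
    have h1 := (hz k' hk' 1).1
    unfold fieldStrength
    linarith
  exact _root_.Literature.MathematicalPhysics.QuantumLattice.phBubble_nonneg hΛ (hpos k hk.1) (hpos (k + q) hk.2)

end Certificate

end Literature.MathematicalPhysics.QuantumLattice
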